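import Summits.AtomisticToContinuum.FouriersLaw.Theorems.LatticeLandauDampingAbelThermodynamicLimitWindowRegularity
import HarnessLib

/-!
# `LatticeLandauDamping.AbelThermodynamicLimit` (crux stmt-AtomisticToContinuum-14013) — the EXACT TWO-PIECE SPLIT, glue proved

Strategist file (`--supports stmt-AtomisticToContinuum-14013`, crux-strategist REDIRECT seat r1 on route `LatticeLandauDamping`;
closes nothing).  The crux ("an Abelian Green–Kubo witness at `T` upgrades to one whose `κ` is the thermodynamic limit of EVERY
finite-chain response sequence `D_N`") is an honest AND-node of TWO pieces, neither of which is the crux or the conjunct reworded: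

* piece 1 — `StaticAbelianSqueeze.UniformAbelianRegularity` (R) (the EXISTING item stmt-AtomisticToContinuum-13416, BY NAME):
  the slow part `∫₀^∞ (1 − e^{−νt}) c_N(t) dt` of the open chain's equilibrium total-current autocorrelation is `≤ εN` for
  `ν < ν₀(ε)`, eventually in `N` — the finiteness content (open-problem class; NECESSARY given the witnesses, by the landed
  `SeriesLawAtEveryLaplaceFrequency.regularityEstimate_of_tendsto`);
* piece 2 — the HONEST shift-invariant Abelian Green–Kubo witness `AGK_SI` (inlined verbatim below; no tree decl): a DLR Gibbs
  state that IS lattice-shift invariant, a measure-preserving infinite-volume dynamics with absolutely convergent current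
  correlations, `κ > 0`, Abel limit `κ` — exactly what this route's deciding theorem `closes` builds from its OWN three spectral
  cruxes `WindowDecomposition` / `NoDrudeWeight` / `PositiveDensity` (stmt-14011 / 14012 / 14014) and the PROVED
  `AbelOfSpectralDensity` (landed one-liner `WindowRegularity.stub_abelGreenKuboSIOfWindow`, p166022).

`abelThermodynamicLimit_of_subs : (R) → AGK_SI → AbelThermodynamicLimit` is the glue: discard the crux's γ-blind hypothesis
witness (γ-blind: the disprover's `exists_witness_iff_gamma`, `Theorems/AbelThermodynamicLimit/Negative/LoadBearing.lean`), take the shift-invariant one, and run the landed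
chain (R) ⇒ repaired crux (`stub_repairedCruxOfUniformAbelianRegularity`, p127738: tightness ⇒ regular DLR state ⇒ same-`κ`
`bmGood` dynamics ⇒ fixed-frequency matching ⇒ (K) ⇒ `integral_abelSplit` ⇒ `tendsto_of_regularity_matching_abel`).
Neither piece alone gives the crux or `FouriersLaw` (BC2/BC7 probes in the strategist folder: 8/8 `C → S`-type probes fail,
3/3 `#h21_crux_probe` CLEAN), and with the route's three spectral cruxes the two pieces give the crux and the conjunct through `closes`
(landed `WindowRegularity.stub_cruxOfRegularityOfWindow` / `fouriersLaw_of_regularity_of_window`, same cone).  Pure composition of landed theorems; standard axioms.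
References: Bonetto–Lebowitz–Rey-Bellet 2000 §7; Kundu–Dhar–Narayan 2009.
-/

noncomputable section

namespace Summit.AtomisticToContinuum.FouriersLaw.Theorems.AbelThermodynamicLimit.Split

open MeasureTheory Filter Set Topology
open Literature.MathematicalPhysics.KineticTheory.HeatConduction

/-- **The split glue `abelThermodynamicLimit_of_subs`: (R) = stmt-13416 and the honest shift-invariant Abelian Green–Kubo
witness give the crux `LatticeLandauDamping.AbelThermodynamicLimit` BY NAME** — `abelThermodynamicLimit_of_uniformAbelianRegularity`
(p127738) fed the seam-free corollary `witnessShiftInvariant_of_abelGreenKuboSI` (p166022). [folklore] -/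
theorem abelThermodynamicLimit_of_subs :
    Summit.AtomisticToContinuum.FouriersLaw.Theses.StaticAbelianSqueeze.UniformAbelianRegularity →
    (
      ∀ ω₂ lam β γ : ℝ, 0 < ω₂ → 0 < lam → 0 < β → 0 < γ → ∀ T : ℝ, 0 < T →
        ∃ (μT : MeasureTheory.Measure Literature.MathematicalPhysics.KineticTheory.HeatConduction.ChainConfig)
          (D : Literature.MathematicalPhysics.KineticTheory.HeatConduction.InfiniteChainDynamics
            (Literature.MathematicalPhysics.KineticTheory.HeatConduction.pinnedChain ω₂ lam β γ)) (κ : ℝ),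
          (Literature.MathematicalPhysics.KineticTheory.HeatConduction.pinnedChain ω₂ lam β γ).IsChainGibbsMeasure T μT ∧
          Literature.MathematicalPhysics.KineticTheory.HeatConduction.IsShiftInvariant μT ∧
          D.PreservesMeasure μT ∧
          (∀ t : ℝ, D.HasAbsConvergentCorrelation μT t) ∧ 0 < κ ∧
          Filter.Tendsto (fun ν : ℝ => (T ^ 2)⁻¹ *
            MeasureTheory.integral (MeasureTheory.volume.restrict (Set.Ioi (0:ℝ)))
              (fun t : ℝ => Real.exp (-(ν * t)) * (D.currentCorrelation μT) t))
            (nhdsWithin (0:ℝ) (Set.Ioi 0)) (nhds κ)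
    ) →
    Summit.AtomisticToContinuum.FouriersLaw.Theses.LatticeLandauDamping.AbelThermodynamicLimit :=
  fun hR hX =>
    Summit.AtomisticToContinuum.FouriersLaw.Theorems.AbelThermodynamicLimit.SeriesLawAtEveryLaplaceFrequency.abelThermodynamicLimit_of_uniformAbelianRegularity
      hR
      (Summit.AtomisticToContinuum.FouriersLaw.Theorems.AbelThermodynamicLimit.WindowRegularity.witnessShiftInvariant_of_abelGreenKuboSI
        hX)

end Summit.AtomisticToContinuum.FouriersLaw.Theorems.AbelThermodynamicLimit.Split

end
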